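import Summits.AtomisticToContinuum.FouriersLaw.Theorems.OddSectorIrreversibilityOddCorrectorDecayClosedFlow
import Summits.AtomisticToContinuum.FouriersLaw.Theorems.OddSectorIrreversibilityOddCorrectorDecayOddPersistence
import Literature.MathematicalPhysics.KineticTheory.OddSectorLocalityHypothesis
import Summits.AtomisticToContinuum.FouriersLaw.Theorems.OddSectorIrreversibilityResponseDensityRiesz

/-!
# The closed pinned chain on `L²(e^{-H/T} dq dp)`: Koopman isometries and odd persistence of the current

Support file for item `stmt-AtomisticToContinuum-9139` (`OddSectorIrreversibility.OddCorrectorDecay`), negative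
side, line `odd-persistence-light-cone`. On the real Hilbert space `E = L²(μ_T)`, `μ_T = e^{-H_N/T} dq dp` the
crux's unnormalised Gibbs weight (`OddSectorLocality.gibbsWeight`), the closed Hamiltonian flow `φ_t` and the
momentum reversal `Θ` act by composition as linear isometries (`Lp.compMeasurePreservingₗᵢ`, using the
measure preservation of `ClosedChainFlow`); the total current `J = ∑_i j_i` is in `L²(μ_T)` and `Θ`-odd.
Feeding the semigroup law, the reversibility `Θ φ_t Θ φ_t = id` and the abstract lemma
`OddPersistence.odd_persistence_of_near` gives the file's deliverable
`odd_persistence_closedChain`: for ANY curve `a : [0, t₀] → L²(μ_T)` of functions with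
`‖a_t - J∘φ_t‖_{L²(μ_T)} ≤ δ`,  `t₀ (√M_N/6 - 2δ) ≤ ∫₀^{t₀} ‖a_t - a_t∘Θ‖_{L²(μ_T)} dt`, `M_N = ‖J‖²`.
(Applied in `Negative/FalseOfBathLocality.lean` to the open-chain forecast `a_t = P_tJ`.)
-/

noncomputable section

open MeasureTheory Filter Topology Set Function
open scoped NNReal ENNReal RealInnerProductSpace
open Literature.MathematicalPhysics.KineticTheory Literature.MathematicalPhysics.KineticTheory.HeatConduction
open Literature.MathematicalPhysics.KineticTheory.OddSectorLocality (gibbsWeight currentNormSq)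
open Summit.AtomisticToContinuum.FouriersLaw.Theorems.ClosedChainFlow

namespace Summit.AtomisticToContinuum.FouriersLaw.Theorems.ClosedChainKoopman

/-! ### Generic `L²` bookkeeping -/

section Generic

variable {α : Type*} [MeasurableSpace α] {μ : Measure α}

/-- Koopman operators of equal maps agree (transport of the measure-preservation proof). [folklore] -/
theorem koopman_congr {f f' : α → α} (h : f = f') (hf : MeasurePreserving f μ μ)
    (hf' : MeasurePreserving f' μ μ) (G : Lp ℝ 2 μ) :
    Lp.compMeasurePreservingₗᵢ ℝ f hf G = Lp.compMeasurePreservingₗᵢ ℝ f' hf' G := by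
  subst h; rfl

/-- Composition of Koopman operators: `(G ∘ g) ∘ f = G ∘ (g ∘ f)`. [folklore] -/
theorem koopman_comp_apply {f g : α → α} (hf : MeasurePreserving f μ μ) (hg : MeasurePreserving g μ μ)
    (G : Lp ℝ 2 μ) :
    Lp.compMeasurePreservingₗᵢ ℝ f hf (Lp.compMeasurePreservingₗᵢ ℝ g hg G) =
      Lp.compMeasurePreservingₗᵢ ℝ (g ∘ f) (hg.comp hf) G :=
  (Lp.compMeasurePreserving_comp_apply G hg hf).symm

/-- The Koopman operator of the identity is the identity. [folklore] -/
theorem koopman_id_apply (G : Lp ℝ 2 μ) :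
    Lp.compMeasurePreservingₗᵢ ℝ id (MeasurePreserving.id μ) G = G :=
  Lp.compMeasurePreserving_id_apply G

/-- The Koopman operator on an `L²` class of a function is the class of the composed function. [folklore] -/
theorem koopman_toLp {f : α → α} (hf : MeasurePreserving f μ μ) {g : α → ℝ} (hg : MemLp g 2 μ) :
    Lp.compMeasurePreservingₗᵢ ℝ f hf (hg.toLp g) = (hg.comp_measurePreserving hf).toLp (g ∘ f) :=
  Lp.toLp_compMeasurePreserving hg hf

end Generic

/-! ### The total current is in `L²(μ_T)` and is `Θ`-odd -/

section Current

variable {ω₂ lam β : ℝ} (hω : 0 < ω₂) (hl : 0 ≤ lam) (hβ : 0 ≤ β) (γ : ℝ) (N : ℕ) {T : ℝ} (hT : 0 < T)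
include hω hl hβ hT

/-- **`J_tot ∈ L²(e^{-H/T} dq dp)`** for the pinned chain (`|j_i| ≤ N(3+β)/2 (1+H)²`, Gaussian domination).
[folklore] -/
theorem memLp_two_totalCurrent :
    MemLp (fun x => ∑ i : Fin N, (pinnedChain ω₂ lam β γ).bondCurrent N i x) 2 (gibbsWeight ω₂ lam β γ T N) := by
  set P := pinnedChain ω₂ lam β γ with hP
  have hJc : Continuous fun x => ∑ i : Fin N, P.bondCurrent N i x :=
    continuous_finsetSum _ fun i _ => pinnedChain_continuous_bondCurrent ω₂ lam β γ N i
  rw [memLp_two_iff_integrable_sq hJc.aestronglyMeasurable]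
  unfold gibbsWeight
  rw [integrable_withDensity_iff_integrable_smul' (measurable_gibbsWeightDensity ω₂ lam β γ T N)
    (Eventually.of_forall fun _ => ENNReal.ofReal_lt_top)]
  -- domination: `J² e^{-H/T} ≤ C e^{-H/(2T)}`
  set K : ℝ := N * (N * ((3 + β) / 2)) with hK
  have hs : 0 < T⁻¹ / 4 := by positivity
  set A : ℝ := 2 * Real.exp (T⁻¹ / 4) / (T⁻¹ / 4) ^ 2 with hA
  have hmaj := (pinnedChain_integrable_exp_neg_mul_hamiltonian hω hl hβ γ N
    (by positivity : 0 < T⁻¹ / 2)).const_mul (K ^ 2 * A ^ 2)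
  refine hmaj.mono' ?_ (Eventually.of_forall fun x => ?_)
  · refine (Measurable.aestronglyMeasurable ?_)
    exact (ENNReal.measurable_toReal.comp (measurable_gibbsWeightDensity ω₂ lam β γ T N)).smul
      (hJc.measurable.pow_const 2)
  have hH0 := pinnedChain_hamiltonian_nonneg hω.le hl hβ γ N x
  have hρ0 : 0 ≤ Real.exp (-P.hamiltonian N x / T) := (Real.exp_pos _).le
  have hJ : |∑ i : Fin N, P.bondCurrent N i x| ≤ K * (1 + P.hamiltonian N x) ^ 2 := by
    calc |∑ i : Fin N, P.bondCurrent N i x| ≤ ∑ i : Fin N, |P.bondCurrent N i x| := Finset.abs_sum_le_sum_abs _ _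
      _ ≤ ∑ _i : Fin N, N * ((3 + β) / 2 * (1 + P.hamiltonian N x) ^ 2) :=
          Finset.sum_le_sum fun i _ => pinnedChain_abs_bondCurrent_le hω.le hl hβ γ N i x
      _ = K * (1 + P.hamiltonian N x) ^ 2 := by
          simp [Finset.sum_const, Finset.card_univ, Fintype.card_fin, hK]; ring
  have hsq := one_add_sq_le_exp hH0 hs
  rw [ENNReal.toReal_ofReal hρ0, Real.norm_eq_abs, smul_eq_mul, abs_mul, abs_of_nonneg hρ0,
    abs_of_nonneg (sq_nonneg _)]
  have hK0 : 0 ≤ K := by positivity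
  have hA0 : 0 ≤ A := by positivity
  have h1 : (∑ i : Fin N, P.bondCurrent N i x) ^ 2 ≤ K ^ 2 * ((1 + P.hamiltonian N x) ^ 2) ^ 2 := by
    have := hJ
    rw [← sq_abs]
    have h0 : 0 ≤ |∑ i : Fin N, P.bondCurrent N i x| := abs_nonneg _
    nlinarith
  have h2 : ((1 + P.hamiltonian N x) ^ 2) ^ 2 ≤ A ^ 2 * Real.exp (T⁻¹ / 4 * P.hamiltonian N x) ^ 2 := by
    rw [← mul_pow]
    exact pow_le_pow_left₀ (by positivity) hsq 2
  have h3 : Real.exp (-P.hamiltonian N x / T) * (Real.exp (T⁻¹ / 4 * P.hamiltonian N x) ^ 2) =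
      Real.exp (-(T⁻¹ / 2 * P.hamiltonian N x)) := by
    rw [← Real.exp_nat_mul, ← Real.exp_add]
    congr 1
    push_cast
    field_simp
    ring
  calc Real.exp (-P.hamiltonian N x / T) * (∑ i : Fin N, P.bondCurrent N i x) ^ 2
      ≤ Real.exp (-P.hamiltonian N x / T) * (K ^ 2 * (A ^ 2 * Real.exp (T⁻¹ / 4 * P.hamiltonian N x) ^ 2)) := by
        refine mul_le_mul_of_nonneg_left (h1.trans ?_) hρ0
        exact mul_le_mul_of_nonneg_left h2 (by positivity)
    _ = K ^ 2 * A ^ 2 * Real.exp (-(T⁻¹ / 2 * P.hamiltonian N x)) := by rw [← h3]; ring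

omit hω hl hβ hT in
/-- The total current is odd under momentum reversal. [folklore] -/
theorem totalCurrent_comp_momentumReversal :
    (fun x => ∑ i : Fin N, (pinnedChain ω₂ lam β γ).bondCurrent N i x) ∘ (momentumReversal N) =
      -fun x => ∑ i : Fin N, (pinnedChain ω₂ lam β γ).bondCurrent N i x := by
  funext x
  simp only [comp_apply, momentumReversal_apply, OscillatorChain.bondCurrent_neg_momentum, Pi.neg_apply,
    Finset.sum_neg_distrib]

end Current

/-! ### Odd persistence of the closed chain's current forecast -/

section Persistence

variable {ω₂ lam β : ℝ} (hω : 0 < ω₂) (hl : 0 ≤ lam) (hβ : 0 ≤ β) (γ : ℝ) {N : ℕ} (hN : 0 < N) {T : ℝ}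
  (hT : 0 < T)
include hω hl hβ hN hT

omit hN hT in
/-- The odd-part integrand of the closed flow is jointly measurable:
`(t, x) ↦ J(φ_{t⁺} x) - J(φ_{t⁺}(Θ x))`. [folklore] -/
theorem measurable_oddIntegrand :
    Measurable fun p : ℝ × PhaseSpace N =>
      (∑ i : Fin N, (pinnedChain ω₂ lam β γ).bondCurrent N i
          ((pinnedChain ω₂ lam β 0).chainFlow N p.2 0 (max p.1 0))) -
        ∑ i : Fin N, (pinnedChain ω₂ lam β γ).bondCurrent N i
          ((pinnedChain ω₂ lam β 0).chainFlow N (p.2.1, -p.2.2) 0 (max p.1 0)) := by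
  have hJc : Continuous fun x => ∑ i : Fin N, (pinnedChain ω₂ lam β γ).bondCurrent N i x :=
    continuous_finsetSum _ fun i _ => pinnedChain_continuous_bondCurrent ω₂ lam β γ N i
  have hfl := measurable_uncurry_closedChainFlow hω hl hβ N
  have h1 : Measurable fun p : ℝ × PhaseSpace N => (max p.1 0, p.2) :=
    (measurable_fst.max measurable_const).prodMk measurable_snd
  have h2 : Measurable fun p : ℝ × PhaseSpace N => (max p.1 0, ((p.2.1, -p.2.2) : PhaseSpace N)) :=
    (measurable_fst.max measurable_const).prodMk ((momentumReversal N).measurable.comp measurable_snd)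
  have hA := hJc.measurable.comp (hfl.comp h1)
  have hB := hJc.measurable.comp (hfl.comp h2)
  exact hA.sub hB

/-- **Odd persistence of the closed chain's current, against any `L²(μ_T)`-near curve.** For the pinned
chain (`ω₂ > 0`, `lam, β ≥ 0`, `N ≥ 1`, `T > 0`), `μ_T = e^{-H/T} dq dp`, `J = ∑_i j_i`, `φ_t` the closed
Hamiltonian flow and `Θ(q,p) = (q,-p)`: if `a : [0, t₀] → L²(μ_T)` is a curve of functions with
`∫ (a_t - J∘φ_t)² dμ_T ≤ δ²` on `[0, t₀]` and `t ↦ ‖a_t - a_t∘Θ‖_{L²(μ_T)}` is integrable on `[0, t₀]`, then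
`t₀ (√M_N / 6 - 2δ) ≤ ∫₀^{t₀} ‖a_t - a_t∘Θ‖_{L²(μ_T)} dt`, `M_N = ∫ J² dμ_T`. Mechanism: `f ↦ f∘φ_t` and
`f ↦ f∘Θ` are linear isometries of `L²(μ_T)` (Liouville + energy conservation; evenness of `H`) with
`φ_{s+t} = φ_t∘φ_s`, `Θφ_tΘφ_t = id`, `J∘Θ = -J`, so `OddPersistence.odd_persistence_of_near` applies.
[folklore] -/
theorem odd_persistence_closedChain {t₀ δ : ℝ} (ht₀ : 0 ≤ t₀) (hδ : 0 ≤ δ) (a : ℝ → PhaseSpace N → ℝ)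
    (ha : ∀ t ∈ Icc (0:ℝ) t₀, MemLp (a t) 2 (gibbsWeight ω₂ lam β γ T N))
    (hnear : ∀ t ∈ Icc (0:ℝ) t₀,
      ∫ x, (a t x - ∑ i : Fin N, (pinnedChain ω₂ lam β γ).bondCurrent N i
        ((pinnedChain ω₂ lam β 0).chainFlow N x 0 t)) ^ 2 ∂(gibbsWeight ω₂ lam β γ T N) ≤ δ ^ 2)
    (hai : IntervalIntegrable (fun t => Real.sqrt (∫ x, (a t x - a t (x.1, -x.2)) ^ 2
        ∂(gibbsWeight ω₂ lam β γ T N))) volume 0 t₀) :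
    t₀ * (Real.sqrt (currentNormSq ω₂ lam β γ T N) / 6 - 2 * δ) ≤
      ∫ t in (0:ℝ)..t₀, Real.sqrt (∫ x, (a t x - a t (x.1, -x.2)) ^ 2 ∂(gibbsWeight ω₂ lam β γ T N)) := by
  -- the Hilbert space, the Koopman isometries, the odd vector
  let μ : Measure (PhaseSpace N) := gibbsWeight ω₂ lam β γ T N
  let J : PhaseSpace N → ℝ := fun x => ∑ i : Fin N, (pinnedChain ω₂ lam β γ).bondCurrent N i x
  let φ : ℝ → PhaseSpace N → PhaseSpace N := fun t x => (pinnedChain ω₂ lam β 0).chainFlow N x 0 (max t 0)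
  have hφmp : ∀ t, MeasurePreserving (φ t) μ μ := fun t =>
    measurePreserving_closedChainFlow_gibbsWeight hω hl hβ hN γ T (le_max_right t 0)
  have hθmp : MeasurePreserving (momentumReversal N) μ μ :=
    measurePreserving_momentumReversal_gibbsWeight ω₂ lam β γ T N
  let U : ℝ → Lp ℝ 2 μ →ₗᵢ[ℝ] Lp ℝ 2 μ := fun t => Lp.compMeasurePreservingₗᵢ ℝ (φ t) (hφmp t)
  let Θ : Lp ℝ 2 μ →ₗᵢ[ℝ] Lp ℝ 2 μ := Lp.compMeasurePreservingₗᵢ ℝ (momentumReversal N) hθmp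
  have hJmem : MemLp J 2 μ := memLp_two_totalCurrent hω hl hβ γ N hT
  let F : Lp ℝ 2 μ := hJmem.toLp J
  haveI : SFinite μ := by dsimp only [μ, gibbsWeight]; infer_instance
  -- (1) semigroup law
  have hUadd : ∀ s t : ℝ, 0 ≤ s → 0 ≤ t → ∀ G, U (s + t) G = U s (U t G) := by
    intro s t hs ht G
    show Lp.compMeasurePreservingₗᵢ ℝ (φ (s + t)) (hφmp (s + t)) G =
      Lp.compMeasurePreservingₗᵢ ℝ (φ s) (hφmp s) (Lp.compMeasurePreservingₗᵢ ℝ (φ t) (hφmp t) G)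
    rw [koopman_comp_apply]
    refine koopman_congr ?_ _ _ G
    funext x
    simp only [comp_apply, φ, max_eq_left hs, max_eq_left ht, max_eq_left (add_nonneg hs ht)]
    exact closedChainFlow_add hω hl hβ N x hs ht
  -- (2) reversibility `Θ φ_t Θ φ_t = id`
  have hrev : ∀ t : ℝ, 0 ≤ t → ∀ G, U t (Θ (U t (Θ G))) = G := by
    intro t ht G
    show Lp.compMeasurePreservingₗᵢ ℝ (φ t) (hφmp t) (Lp.compMeasurePreservingₗᵢ ℝ _ hθmp
      (Lp.compMeasurePreservingₗᵢ ℝ (φ t) (hφmp t) (Lp.compMeasurePreservingₗᵢ ℝ _ hθmp G))) = G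
    rw [koopman_comp_apply, koopman_comp_apply, koopman_comp_apply]
    refine (koopman_congr ?_ _ (MeasurePreserving.id μ) G).trans (koopman_id_apply G)
    funext x
    simp only [comp_apply, id_eq, φ, max_eq_left ht, momentumReversal_apply]
    exact momentumReversal_closedChainFlow_momentumReversal_closedChainFlow hω hl hβ N x ht
  -- (3) oddness of the current
  have hodd : Θ F = -F := by
    show Lp.compMeasurePreservingₗᵢ ℝ _ hθmp (hJmem.toLp J) = -hJmem.toLp J
    rw [koopman_toLp, ← MemLp.toLp_neg]
    exact MemLp.toLp_congr _ _ (Eventually.of_forall fun x => by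
      simp [J, OscillatorChain.bondCurrent_neg_momentum, Finset.sum_neg_distrib])
  -- (4) the odd-part norm as an integral, for every real time
  have hnormU : ∀ t : ℝ, ‖U t F - Θ (U t F)‖ =
      Real.sqrt (∫ x, (J (φ t x) - J (φ t (x.1, -x.2))) ^ 2 ∂μ) := by
    intro t
    have h1 : U t F = (hJmem.comp_measurePreserving (hφmp t)).toLp (J ∘ φ t) := koopman_toLp _ _
    have hm2 : MemLp ((J ∘ φ t) ∘ momentumReversal N) 2 μ :=
      (hJmem.comp_measurePreserving (hφmp t)).comp_measurePreserving hθmp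
    have h2 : Θ (U t F) = hm2.toLp ((J ∘ φ t) ∘ momentumReversal N) := by rw [h1]; exact koopman_toLp _ _
    rw [h2, h1, ← MemLp.toLp_sub, norm_toLp_two_eq_sqrt]
    rfl
  -- (5) interval integrability of the odd-part norm (measurable and bounded by `2‖F‖`)
  have hfi : IntervalIntegrable (fun t => ‖U t F - Θ (U t F)‖) volume 0 t₀ := by
    have hmeas : Measurable fun t => ‖U t F - Θ (U t F)‖ := by
      have h := (measurable_oddIntegrand hω hl hβ γ (N := N)).pow_const 2
      have hsm : StronglyMeasurable fun t : ℝ => ∫ x, (fun p : ℝ × PhaseSpace N =>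
          ((∑ i : Fin N, (pinnedChain ω₂ lam β γ).bondCurrent N i
            ((pinnedChain ω₂ lam β 0).chainFlow N p.2 0 (max p.1 0))) -
           ∑ i : Fin N, (pinnedChain ω₂ lam β γ).bondCurrent N i
            ((pinnedChain ω₂ lam β 0).chainFlow N (p.2.1, -p.2.2) 0 (max p.1 0))) ^ 2) (t, x) ∂μ :=
        h.stronglyMeasurable.integral_prod_right
      have : (fun t => ‖U t F - Θ (U t F)‖) = fun t => Real.sqrt (∫ x, (fun p : ℝ × PhaseSpace N =>
          ((∑ i : Fin N, (pinnedChain ω₂ lam β γ).bondCurrent N i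
            ((pinnedChain ω₂ lam β 0).chainFlow N p.2 0 (max p.1 0))) -
           ∑ i : Fin N, (pinnedChain ω₂ lam β γ).bondCurrent N i
            ((pinnedChain ω₂ lam β 0).chainFlow N (p.2.1, -p.2.2) 0 (max p.1 0))) ^ 2) (t, x) ∂μ) := by
        funext t; rw [hnormU t]
      rw [this]
      exact Real.continuous_sqrt.measurable.comp hsm.measurable
    have hbd : ∀ t, ‖(‖U t F - Θ (U t F)‖)‖ ≤ 2 * ‖F‖ := by
      intro t
      rw [Real.norm_eq_abs, abs_of_nonneg (norm_nonneg _)]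
      calc ‖U t F - Θ (U t F)‖ ≤ ‖U t F‖ + ‖Θ (U t F)‖ := norm_sub_le _ _
        _ = 2 * ‖F‖ := by simp only [LinearIsometry.norm_map]; ring
    rw [intervalIntegrable_iff_integrableOn_Icc_of_le ht₀]
    exact Measure.integrableOn_of_bounded measure_Icc_lt_top.ne hmeas.aestronglyMeasurable
      (ae_of_all _ hbd)
  -- (6) the curve of forecasts as a curve in `L²`
  let A : ℝ → Lp ℝ 2 μ := fun t => if h : t ∈ Icc (0:ℝ) t₀ then (ha t h).toLp (a t) else 0
  have hA : ∀ {t} (h : t ∈ Icc (0:ℝ) t₀), A t = (ha t h).toLp (a t) := fun h => dif_pos h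
  have hnormA : ∀ t ∈ Icc (0:ℝ) t₀, ‖A t - Θ (A t)‖ = Real.sqrt (∫ x, (a t x - a t (x.1, -x.2)) ^ 2 ∂μ) := by
    intro t ht
    have hm2 : MemLp (a t ∘ momentumReversal N) 2 μ := (ha t ht).comp_measurePreserving hθmp
    have h2 : Θ (A t) = hm2.toLp (a t ∘ momentumReversal N) := by rw [hA ht]; exact koopman_toLp _ _
    rw [h2, hA ht, ← MemLp.toLp_sub, norm_toLp_two_eq_sqrt]
    rfl
  have hnear' : ∀ t ∈ Icc (0:ℝ) t₀, ‖A t - U t F‖ ≤ δ := by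
    intro t ht
    have h1 : U t F = (hJmem.comp_measurePreserving (hφmp t)).toLp (J ∘ φ t) := koopman_toLp _ _
    rw [h1, hA ht, ← MemLp.toLp_sub, norm_toLp_two_eq_sqrt]
    calc Real.sqrt (∫ x, (a t - J ∘ φ t) x ^ 2 ∂μ) ≤ Real.sqrt (δ ^ 2) := by
          refine Real.sqrt_le_sqrt ?_
          have := hnear t ht
          simp only [φ, max_eq_left ht.1]
          exact this
      _ = δ := Real.sqrt_sq hδ
  have hai' : IntervalIntegrable (fun t => ‖A t - Θ (A t)‖) volume 0 t₀ := by
    refine hai.congr fun t ht => ?_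
    rw [uIoc_of_le ht₀] at ht
    exact (hnormA t (Ioc_subset_Icc_self ht)).symm
  -- (7) the abstract lemma
  have key := OddPersistence.odd_persistence_of_near U Θ F hUadd hrev hodd ht₀ A hnear' hfi hai'
  have hFnorm : ‖F‖ = Real.sqrt (currentNormSq ω₂ lam β γ T N) := norm_toLp_two_eq_sqrt hJmem
  rw [hFnorm] at key
  refine key.trans (le_of_eq ?_)
  refine intervalIntegral.integral_congr fun t ht => ?_
  rw [uIcc_of_le ht₀] at ht
  exact hnormA t ht

end Persistence

end Summit.AtomisticToContinuum.FouriersLaw.Theorems.ClosedChainKoopman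

end
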